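import Summits.Parity.GeneralizedHardyLittlewood.Theses.RomanoffHeathBrown
import Literature.NumberTheory.Sieve.HeathBrownWeightClassSums
import Literature.NumberTheory.Sieve.HeathBrownWeightFourthMoment
import Literature.NumberTheory.Sieve.PrimePairsSieveBound

/-! # RomanoffHeathBrown — tools for the pair-sieve reduction of the second moment
(helpers for item stmt-Parity-20275 `SecondMomentReduction` of `route-Parity-RomanoffHeathBrown`)

Elementary bookkeeping used by Romanoff's second-moment argument for `P + A`, `A` = the Heath-Brown
primes `x³ + 2y³` (weight `u = hbWeight c N`):
* shifted sums `∑_{n ≤ 2N} g(n − k) ≤ ∑_{m ≤ 2N} g(m)` (ℕ-subtraction, `g(0) = 0`);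
* Chebyshev bounds for a weight `θ` supported on the primes `≤ N` with `θ(m) ≤ log m`:
  `∑ θ ≤ log 4 · N`, `∑ θ² ≤ log N · log 4 · N`, and the shifted correlation
  `∑_m θ(m+h) θ(m) ≤ (log N)² · #{p ≤ N : p + h prime}`;
* the divisor switch `h/φ(h) ≤ 2 ∑_{d ∣ h, d odd squarefree} ∏_{p ∣ d} 1/(p − 2)`;
* the class-energy identity `∑_{r mod d} U_d(r)² = ∑_{k ≡ k' (d)} u(k) u(k')` and the swap of the
  `d`- and `(k, k')`-sums;
* the pointwise bound `u(k) ≤ N^{1/3} log N (ηX + 2)` (`hbRep ≤ hbSide ≤ ηX + 1`).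
Sources: [Nathanson1996] (§7.6, Romanoff's theorem), [MontgomeryVaughan2007] (Cor. 3.14). -/

noncomputable section

open Finset Filter
open scoped Topology

namespace Summit.Parity.GeneralizedHardyLittlewood.Theses.RomanoffHeathBrown

open Literature.NumberTheory.Sieve Literature.NumberTheory.Sieve.CubicPrimes
open Literature.NumberTheory.Sieve.CubicMinorant

/-! ## Shifted sums over `n ≤ 2N` -/

/-- `∑_{1 ≤ n ≤ 2N} g(n − k) ≤ ∑_{m ≤ 2N} g(m)` for `g ≥ 0` with `g(0) = 0` (ℕ-subtraction: the
terms with `n ≤ k` vanish, the others are a shift). [folklore] -/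
theorem sum_Icc_sub_le {g : ℕ → ℝ} (hg0 : g 0 = 0) (hg : ∀ m, 0 ≤ g m) (N k : ℕ) :
    ∑ n ∈ Icc 1 (2 * N), g (n - k) ≤ ∑ m ∈ range (2 * N + 1), g m := by
  calc ∑ n ∈ Icc 1 (2 * N), g (n - k) ≤ ∑ n ∈ range (k + (2 * N + 1)), g (n - k) :=
        Finset.sum_le_sum_of_subset_of_nonneg
          (fun n hn => by rw [mem_Icc] at hn; rw [mem_range]; omega) (fun n _ _ => hg _)
    _ = ∑ m ∈ range (2 * N + 1), g m := by
        rw [Finset.sum_range_add]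
        have h1 : ∑ n ∈ range k, g (n - k) = 0 := Finset.sum_eq_zero fun n hn => by
          rw [mem_range] at hn
          rw [Nat.sub_eq_zero_of_le hn.le, hg0]
        rw [h1, zero_add]
        exact Finset.sum_congr rfl fun m _ => by rw [Nat.add_sub_cancel_left]

/-! ## Chebyshev-type bounds for a weight supported on the primes `≤ N` -/

section Theta

variable {N : ℕ} {θ : ℕ → ℝ} (hθ0 : ∀ m, 0 ≤ θ m)
  (hθ : ∀ m, θ m ≠ 0 → m.Prime ∧ m ≤ N ∧ θ m ≤ Real.log m)
include hθ

/-- Such a weight vanishes at `0` (`0` is not prime). [folklore] -/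
theorem theta_zero : θ 0 = 0 := by
  by_contra h
  exact Nat.not_prime_zero (hθ 0 h).1

/-- Such a weight is at most `log N` everywhere. [folklore] -/
theorem theta_le_log (m : ℕ) : θ m ≤ Real.log N := by
  by_cases h : θ m = 0
  · rw [h]; exact Real.log_natCast_nonneg N
  · obtain ⟨hp, hmN, hle⟩ := hθ m h
    exact hle.trans (Real.log_le_log (by exact_mod_cast hp.pos) (by exact_mod_cast hmN))

/-- **Chebyshev**: `∑_{m ≤ 2N} θ(m) ≤ ∑_{p ≤ N} log p = ϑ(N) ≤ log 4 · N`
(Mathlib `Chebyshev.theta_le_log4_mul_x`). [folklore] -/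
theorem sum_theta_le : ∑ m ∈ range (2 * N + 1), θ m ≤ Real.log 4 * N := by
  calc ∑ m ∈ range (2 * N + 1), θ m
      = ∑ m ∈ (range (2 * N + 1)).filter (fun m => θ m ≠ 0), θ m :=
        (Finset.sum_filter_ne_zero _).symm
    _ ≤ ∑ m ∈ (range (2 * N + 1)).filter (fun m => θ m ≠ 0), Real.log m :=
        Finset.sum_le_sum fun m hm => (hθ m (mem_filter.mp hm).2).2.2
    _ ≤ ∑ p ∈ Nat.primesLE N, Real.log p := by
        refine Finset.sum_le_sum_of_subset_of_nonneg (fun m hm => ?_)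
          (fun p _ _ => Real.log_natCast_nonneg p)
        obtain ⟨-, hne⟩ := mem_filter.mp hm
        obtain ⟨hp, hmN, -⟩ := hθ m hne
        exact Nat.mem_primesLE.mpr ⟨hmN, hp⟩
    _ = Chebyshev.theta N := (Chebyshev.theta_eq_sum_primesLE_log N).symm
    _ ≤ Real.log 4 * N := Chebyshev.theta_le_log4_mul_x (Nat.cast_nonneg N)

include hθ0

/-- `∑_{m ≤ 2N} θ(m)² ≤ log N · log 4 · N`. [folklore] -/
theorem sum_theta_sq_le : ∑ m ∈ range (2 * N + 1), θ m ^ 2 ≤ Real.log N * (Real.log 4 * N) := by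
  calc ∑ m ∈ range (2 * N + 1), θ m ^ 2 ≤ ∑ m ∈ range (2 * N + 1), Real.log N * θ m :=
        Finset.sum_le_sum fun m _ => by
          rw [sq]; exact mul_le_mul_of_nonneg_right (theta_le_log hθ m) (hθ0 m)
    _ = Real.log N * ∑ m ∈ range (2 * N + 1), θ m := (Finset.mul_sum _ _ _).symm
    _ ≤ Real.log N * (Real.log 4 * N) :=
        mul_le_mul_of_nonneg_left (sum_theta_le hθ) (Real.log_natCast_nonneg N)

/-- The shifted correlation through the support: for a shift `h`,
`∑_{m ≤ 2N} θ(m + h) θ(m) ≤ (log N)² · #{p ≤ N : p + h prime}`. [folklore] -/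
theorem sum_theta_shift_mul_le (h : ℕ) :
    ∑ m ∈ range (2 * N + 1), θ (m + h) * θ m ≤
      Real.log N ^ 2 * #{p ∈ Nat.primesLE N | (p + h).Prime} := by
  calc ∑ m ∈ range (2 * N + 1), θ (m + h) * θ m
      ≤ ∑ m ∈ range (2 * N + 1),
          (if m ∈ {p ∈ Nat.primesLE N | (p + h).Prime} then Real.log N ^ 2 else 0) := by
        refine Finset.sum_le_sum fun m _ => ?_
        split_ifs with hm
        · rw [sq]
          exact mul_le_mul (theta_le_log hθ _) (theta_le_log hθ _) (hθ0 m)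
            (Real.log_natCast_nonneg N)
        · by_contra hne
          have hprod : θ (m + h) * θ m ≠ 0 := fun e => hne e.le
          obtain ⟨h1, h2⟩ := mul_ne_zero_iff.mp hprod
          obtain ⟨hp1, -, -⟩ := hθ _ h1
          obtain ⟨hp2, hmN, -⟩ := hθ _ h2
          exact hm (mem_filter.mpr ⟨Nat.mem_primesLE.mpr ⟨hmN, hp2⟩, hp1⟩)
    _ = #(range (2 * N + 1) ∩ {p ∈ Nat.primesLE N | (p + h).Prime}) * Real.log N ^ 2 := by
        rw [Finset.sum_ite_mem, Finset.sum_const, nsmul_eq_mul]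
    _ ≤ #{p ∈ Nat.primesLE N | (p + h).Prime} * Real.log N ^ 2 := by
        gcongr; exact Finset.inter_subset_right
    _ = _ := mul_comm _ _

end Theta

/-! ## The divisor switch `h/φ(h) ≤ 2 ∑_{d ∣ h, d odd squarefree} ∏_{p ∣ d} 1/(p − 2)` -/

/-- `g(d) = ∏_{p ∣ d} 1/(p − 2) ≥ 0` for odd `d` (all prime factors are `≥ 3`). [folklore] -/
theorem prod_primeFactors_inv_sub_two_nonneg {d : ℕ} (hd : Odd d) :
    0 ≤ ∏ p ∈ d.primeFactors, (1 : ℝ) / ((p : ℝ) - 2) := by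
  refine Finset.prod_nonneg fun p hp => ?_
  have hpp := Nat.prime_of_mem_primeFactors hp
  have hp2 : p ≠ 2 := by
    rintro rfl
    exact (Nat.not_even_iff_odd.mpr hd) (even_iff_two_dvd.mpr (Nat.dvd_of_mem_primeFactors hp))
  have h3 : 3 ≤ p := by have := hpp.two_le; omega
  have h3' : (3 : ℝ) ≤ p := by exact_mod_cast h3
  have : (0 : ℝ) < (p : ℝ) - 2 := by linarith
  positivity

/-- **The divisor switch**: for `1 ≤ h ≤ N`,
`h/φ(h) = ∏_{p ∣ h} p/(p−1) ≤ 2 ∏_{p ∣ h, p odd} (1 + 1/(p−2)) = 2 ∑_{d ∣ h, d odd squarefree} ∏_{p ∣ d} 1/(p−2)`,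
the `d` ranging inside `[1, N]`. [cite: Nathanson1996, §7.6 (proof of Romanoff's theorem)] -/
theorem self_div_totient_le {N h : ℕ} (h1 : 1 ≤ h) (hhN : h ≤ N) :
    (h : ℝ) / (Nat.totient h : ℝ) ≤
      2 * ∑ d ∈ ((Icc 1 N).filter (fun d : ℕ => Squarefree d ∧ Odd d)).filter (fun d : ℕ => d ∣ h),
        ∏ p ∈ d.primeFactors, (1 : ℝ) / ((p : ℝ) - 2) := by
  classical
  set P := h.primeFactors with hP
  have hPprime : ∀ p ∈ P, p.Prime := fun p hp => Nat.prime_of_mem_primeFactors hp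
  -- Step 1: `h/φ(h) = ∏_{p ∣ h} p/(p-1)`
  have key : (h.totient : ℝ) * ∏ p ∈ P, (p : ℝ) = h * ∏ p ∈ P, ((p : ℝ) - 1) := by
    have e := Nat.totient_mul_prod_primeFactors h
    have e' : ((h.totient * ∏ p ∈ h.primeFactors, p : ℕ) : ℝ) =
        ((h * ∏ p ∈ h.primeFactors, (p - 1) : ℕ) : ℝ) := by rw [e]
    rw [Nat.cast_mul, Nat.cast_mul, Nat.cast_prod, Nat.cast_prod] at e'
    rw [e']
    congr 1
    refine Finset.prod_congr rfl fun p hp => ?_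
    rw [Nat.cast_sub (hPprime p hp).pos, Nat.cast_one]
  have hP1 : 0 < ∏ p ∈ P, ((p : ℝ) - 1) := Finset.prod_pos fun p hp => by
    have : (2 : ℝ) ≤ p := by exact_mod_cast (hPprime p hp).two_le
    linarith
  have hφ0 : 0 < (h.totient : ℝ) := by exact_mod_cast Nat.totient_pos.mpr (by omega)
  have hratio : (h : ℝ) / h.totient = ∏ p ∈ P, ((p : ℝ) / ((p : ℝ) - 1)) := by
    rw [Finset.prod_div_distrib, div_eq_div_iff hφ0.ne' hP1.ne']
    linarith [key]
  -- Step 2: split off `p = 2`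
  set O := P.filter (fun p : ℕ => ¬ p = 2) with hO
  have hsplit : ∏ p ∈ P, ((p : ℝ) / ((p : ℝ) - 1)) =
      (∏ p ∈ P.filter (fun p : ℕ => p = 2), ((p : ℝ) / ((p : ℝ) - 1))) *
        ∏ p ∈ O, ((p : ℝ) / ((p : ℝ) - 1)) :=
    (Finset.prod_filter_mul_prod_filter_not P (fun p : ℕ => p = 2) _).symm
  have h2le : ∏ p ∈ P.filter (fun p : ℕ => p = 2), ((p : ℝ) / ((p : ℝ) - 1)) ≤ 2 := by
    by_cases h2 : (2 : ℕ) ∈ P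
    · have : P.filter (fun p : ℕ => p = 2) = {2} := by
        ext p
        simp only [mem_filter, mem_singleton]
        exact ⟨fun h => h.2, fun h => ⟨h ▸ h2, h⟩⟩
      rw [this, Finset.prod_singleton]; norm_num
    · have : P.filter (fun p : ℕ => p = 2) = ∅ := by
        ext p
        simp only [mem_filter, Finset.notMem_empty, iff_false, not_and]
        rintro hp rfl
        exact h2 hp
      rw [this, Finset.prod_empty]; norm_num
  have hOprime : ∀ p ∈ O, p.Prime ∧ p ≠ 2 := fun p hp =>
    ⟨hPprime p (mem_filter.mp hp).1, (mem_filter.mp hp).2⟩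
  have hO3 : ∀ p ∈ O, (3 : ℝ) ≤ p := fun p hp => by
    obtain ⟨hpp, hp2⟩ := hOprime p hp
    have : 3 ≤ p := by have := hpp.two_le; omega
    exact_mod_cast this
  -- Step 3: `p/(p-1) ≤ 1 + 1/(p-2)` for odd `p`, then expand the product over subsets
  have hOle : ∏ p ∈ O, ((p : ℝ) / ((p : ℝ) - 1)) ≤
      ∑ T ∈ O.powerset, ∏ p ∈ T, (1 : ℝ) / ((p : ℝ) - 2) := by
    rw [← Finset.prod_one_add]
    refine Finset.prod_le_prod (fun p hp => ?_) (fun p hp => ?_)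
    · have := hO3 p hp
      have : (0 : ℝ) < (p : ℝ) - 1 := by linarith
      positivity
    · have h3 := hO3 p hp
      have hp2 : (0 : ℝ) < (p : ℝ) - 2 := by linarith
      have hfrac : 1 ≤ ((p : ℝ) - 1) / ((p : ℝ) - 2) := by rw [le_div_iff₀ hp2]; linarith
      rw [div_le_iff₀ (by linarith : (0 : ℝ) < (p : ℝ) - 1)]
      calc (p : ℝ) ≤ ((p : ℝ) - 1) + ((p : ℝ) - 1) / ((p : ℝ) - 2) := by linarith
        _ = (1 + 1 / ((p : ℝ) - 2)) * ((p : ℝ) - 1) := by ring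
  -- Step 4: re-index the subsets `T` by the odd square-free divisors `d = ∏ T`
  have hTprime : ∀ T ∈ O.powerset, ∀ p ∈ T, p.Prime := fun T hT p hp =>
    (hOprime p (Finset.mem_powerset.mp hT hp)).1
  have hinj : Set.InjOn (fun T : Finset ℕ => ∏ p ∈ T, p) (O.powerset : Set (Finset ℕ)) := by
    intro T hT T' hT' heq
    have e1 := Nat.primeFactors_prod (hTprime T hT)
    have e2 := Nat.primeFactors_prod (hTprime T' hT')
    rw [← e1, ← e2]
    exact congrArg Nat.primeFactors heq
  have hsum : ∑ T ∈ O.powerset, ∏ p ∈ T, (1 : ℝ) / ((p : ℝ) - 2) =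
      ∑ d ∈ O.powerset.image (fun T : Finset ℕ => ∏ p ∈ T, p),
        ∏ p ∈ d.primeFactors, (1 : ℝ) / ((p : ℝ) - 2) := by
    rw [Finset.sum_image hinj]
    refine Finset.sum_congr rfl fun T hT => ?_
    rw [Nat.primeFactors_prod (hTprime T hT)]
  have hsub : O.powerset.image (fun T : Finset ℕ => ∏ p ∈ T, p) ⊆
      ((Icc 1 N).filter (fun d : ℕ => Squarefree d ∧ Odd d)).filter (fun d : ℕ => d ∣ h) := by
    intro d hd
    obtain ⟨T, hT, rfl⟩ := Finset.mem_image.mp hd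
    have hTO : T ⊆ O := Finset.mem_powerset.mp hT
    have hTp := hTprime T hT
    have hd0 : (∏ p ∈ T, p) ≠ 0 := Finset.prod_ne_zero_iff.mpr fun p hp => (hTp p hp).ne_zero
    have hdvd : (∏ p ∈ T, p) ∣ h :=
      (Finset.prod_dvd_prod_of_subset T P (fun p => p) (hTO.trans (Finset.filter_subset _ _))).trans
        (Nat.prod_primeFactors_dvd h)
    have hsq : Squarefree (∏ p ∈ T, p) := by
      refine Finset.squarefree_prod_of_pairwise_isCoprime (fun p hp q hq hne => ?_)
        (fun p hp => (hTp p hp).prime.squarefree)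
      exact Nat.coprime_iff_isRelPrime.mp ((Nat.coprime_primes (hTp p hp) (hTp q hq)).mpr hne)
    have hodd : Odd (∏ p ∈ T, p) := by
      refine Nat.not_even_iff_odd.mp fun hev => ?_
      obtain ⟨p, hp, h2p⟩ :=
        (Nat.prime_two.prime.dvd_finsetProd_iff (fun p => p)).mp (even_iff_two_dvd.mp hev)
      have := (Nat.prime_dvd_prime_iff_eq Nat.prime_two (hTp p hp)).mp h2p
      exact (hOprime p (hTO hp)).2 this.symm
    refine mem_filter.mpr ⟨mem_filter.mpr ⟨mem_Icc.mpr ⟨Nat.pos_of_ne_zero hd0, ?_⟩, hsq, hodd⟩, hdvd⟩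
    exact (Nat.le_of_dvd (by omega) hdvd).trans hhN
  -- combine
  calc (h : ℝ) / h.totient = ∏ p ∈ P, ((p : ℝ) / ((p : ℝ) - 1)) := hratio
    _ = (∏ p ∈ P.filter (fun p : ℕ => p = 2), ((p : ℝ) / ((p : ℝ) - 1))) *
          ∏ p ∈ O, ((p : ℝ) / ((p : ℝ) - 1)) := hsplit
    _ ≤ 2 * ∑ T ∈ O.powerset, ∏ p ∈ T, (1 : ℝ) / ((p : ℝ) - 2) := by
        refine mul_le_mul h2le hOle (Finset.prod_nonneg fun p hp => ?_) (by norm_num)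
        have := hO3 p hp
        have : (0 : ℝ) < (p : ℝ) - 1 := by linarith
        positivity
    _ = 2 * ∑ d ∈ O.powerset.image (fun T : Finset ℕ => ∏ p ∈ T, p),
          ∏ p ∈ d.primeFactors, (1 : ℝ) / ((p : ℝ) - 2) := by rw [hsum]
    _ ≤ _ :=
        mul_le_mul_of_nonneg_left (Finset.sum_le_sum_of_subset_of_nonneg hsub fun d hd _ =>
          prod_primeFactors_inv_sub_two_nonneg (mem_filter.mp (mem_filter.mp hd).1).2.2) (by norm_num)

/-! ## Class energies -/

/-- **Class-energy identity**: for `d ≥ 1`,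
`∑_{r < d} (∑_{k ∈ K, k ≡ r (d)} u(k))² = ∑_{k, k' ∈ K} [k ≡ k' (d)] u(k) u(k')`. [folklore] -/
theorem sum_range_classSum_sq {d : ℕ} (hd : 0 < d) (K : Finset ℕ) (u : ℕ → ℝ) :
    ∑ r ∈ range d, (∑ k ∈ K.filter (fun k : ℕ => k ≡ r [MOD d]), u k) ^ 2 =
      ∑ k ∈ K, ∑ k' ∈ K, if k ≡ k' [MOD d] then u k * u k' else 0 := by
  have hfilt : ∀ r ∈ range d,
      K.filter (fun k : ℕ => k ≡ r [MOD d]) = K.filter (fun k : ℕ => k % d = r) := by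
    intro r hr
    refine Finset.filter_congr fun k _ => ?_
    show k % d = r % d ↔ k % d = r
    rw [Nat.mod_eq_of_lt (mem_range.mp hr)]
  calc ∑ r ∈ range d, (∑ k ∈ K.filter (fun k : ℕ => k ≡ r [MOD d]), u k) ^ 2
      = ∑ r ∈ range d, ∑ k ∈ K.filter (fun k : ℕ => k % d = r),
          u k * ∑ k' ∈ K.filter (fun k' : ℕ => k ≡ k' [MOD d]), u k' := by
        refine Finset.sum_congr rfl fun r hr => ?_
        rw [sq, Finset.sum_mul, hfilt r hr]
        refine Finset.sum_congr rfl fun k hk => ?_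
        congr 1
        refine Finset.sum_congr (Finset.filter_congr fun k' _ => ?_) fun _ _ => rfl
        show k' % d = r ↔ k % d = k' % d
        rw [(mem_filter.mp hk).2, eq_comm]
    _ = ∑ k ∈ K, u k * ∑ k' ∈ K.filter (fun k' : ℕ => k ≡ k' [MOD d]), u k' :=
        Finset.sum_fiberwise_of_maps_to (fun k _ => mem_range.mpr (Nat.mod_lt k hd)) _
    _ = _ := by
        refine Finset.sum_congr rfl fun k _ => ?_
        rw [Finset.mul_sum, Finset.sum_filter]

/-- **Swapping the divisor sum with the pair sum**:
`∑_{k, k'} u(k) u(k') ∑_{d ∈ D, k ≡ k' (d)} g(d) = ∑_{d ∈ D} g(d) ∑_{k, k'} [k ≡ k' (d)] u(k) u(k')`.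
[folklore] -/
theorem sum_sum_mul_sum_filter_modEq (D K : Finset ℕ) (g u : ℕ → ℝ) :
    ∑ k ∈ K, ∑ k' ∈ K, u k * u k' * ∑ d ∈ D.filter (fun d : ℕ => k ≡ k' [MOD d]), g d =
      ∑ d ∈ D, g d * ∑ k ∈ K, ∑ k' ∈ K, if k ≡ k' [MOD d] then u k * u k' else 0 := by
  have h1 : ∀ k k' : ℕ, u k * u k' * ∑ d ∈ D.filter (fun d : ℕ => k ≡ k' [MOD d]), g d =
      ∑ d ∈ D, if k ≡ k' [MOD d] then g d * (u k * u k') else 0 := by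
    intro k k'
    rw [Finset.sum_filter, Finset.mul_sum]
    refine Finset.sum_congr rfl fun d _ => ?_
    split_ifs <;> ring
  simp_rw [h1]
  calc ∑ k ∈ K, ∑ k' ∈ K, ∑ d ∈ D, (if k ≡ k' [MOD d] then g d * (u k * u k') else 0)
      = ∑ k ∈ K, ∑ d ∈ D, ∑ k' ∈ K, (if k ≡ k' [MOD d] then g d * (u k * u k') else 0) :=
        Finset.sum_congr rfl fun _ _ => Finset.sum_comm
    _ = ∑ d ∈ D, ∑ k ∈ K, ∑ k' ∈ K, (if k ≡ k' [MOD d] then g d * (u k * u k') else 0) :=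
        Finset.sum_comm
    _ = _ := by
        refine Finset.sum_congr rfl fun d _ => ?_
        rw [Finset.mul_sum]
        refine Finset.sum_congr rfl fun k _ => ?_
        rw [Finset.mul_sum]
        refine Finset.sum_congr rfl fun k' _ => ?_
        split_ifs <;> ring

/-- Expanding the square of a sum and bringing the `n`-sum inside:
`∑_n (∑_k a(n,k))² = ∑_{k,k'} ∑_n a(n,k) a(n,k')`. [folklore] -/
theorem sum_sq_sum_eq (S K : Finset ℕ) (a : ℕ → ℕ → ℝ) :
    ∑ n ∈ S, (∑ k ∈ K, a n k) ^ 2 = ∑ k ∈ K, ∑ k' ∈ K, ∑ n ∈ S, a n k * a n k' := by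
  calc ∑ n ∈ S, (∑ k ∈ K, a n k) ^ 2 = ∑ n ∈ S, ∑ k ∈ K, ∑ k' ∈ K, a n k * a n k' :=
        Finset.sum_congr rfl fun n _ => by rw [sq, Finset.sum_mul_sum]
    _ = ∑ k ∈ K, ∑ n ∈ S, ∑ k' ∈ K, a n k * a n k' := Finset.sum_comm
    _ = _ := Finset.sum_congr rfl fun _ _ => Finset.sum_comm

/-! ## The pointwise bound on the Heath-Brown weight -/

/-- `hbRep c N k ≤ L = hbSide c N`: a representing pair `(x, y)` is determined by `y`
(`x³ = k − 2y³`), and `y ∈ (⌊X⌋, ⌊X(1+η)⌋]`. [cite: HeathBrownActa2001, §2 (2.2)] -/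
theorem hbRep_le_hbSide (c : ℝ) (N k : ℕ) : hbRep c N k ≤ hbSide c N := by
  unfold hbRep
  rw [hbSide_def, ← Nat.card_Ioc]
  refine Finset.card_le_card_of_injOn Prod.snd (fun xy hxy => ?_) (fun xy hxy xy' hxy' heq => ?_)
  · rw [Finset.mem_coe, Finset.mem_filter] at hxy
    obtain ⟨x, y⟩ := xy
    obtain ⟨-, -, hy1, hy2, -, -⟩ := mem_primePairs_iff.mp hxy.1
    rw [Finset.mem_coe, Finset.mem_Ioc]
    exact ⟨(Nat.floor_lt (hbX_nonneg N)).mpr hy1, Nat.le_floor hy2⟩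
  · rw [Finset.mem_coe, Finset.mem_filter] at hxy hxy'
    have hv : xy.1 ^ 3 + 2 * xy.2 ^ 3 = xy'.1 ^ 3 + 2 * xy'.2 ^ 3 := by rw [hxy.2, hxy'.2]
    have heq' : xy.2 = xy'.2 := heq
    rw [heq'] at hv
    have h3 : xy.1 ^ 3 = xy'.1 ^ 3 := by omega
    exact Prod.ext (Nat.pow_left_injective three_ne_zero h3) heq'

/-- `L = ⌊X(1+η)⌋ − ⌊X⌋ ≤ ηX + 1` for `N > 6` (so that `X > 1`, `η > 0`).
[cite: HeathBrownActa2001, Theorem 1 (the box X < x, y ≤ X(1+η))] -/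
theorem hbSide_le_eta_mul_X_add_one (c : ℝ) {N : ℕ} (hN : 6 < N) :
    (hbSide c N : ℝ) ≤ hbEta c N * hbX N + 1 := by
  obtain ⟨hX1, hLX, -⟩ := hbX_facts hN
  have hX := hbX_nonneg N
  have hη0 : 0 ≤ hbEta c N := by unfold hbEta; exact Real.rpow_nonneg hLX.le _
  have hY : hbX N ≤ hbX N * (1 + hbEta c N) := by nlinarith
  have hAM : ⌊hbX N⌋₊ ≤ ⌊hbX N * (1 + hbEta c N)⌋₊ := Nat.floor_le_floor hY
  rw [hbSide_def, Nat.cast_sub hAM]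
  have h1 : (⌊hbX N * (1 + hbEta c N)⌋₊ : ℝ) ≤ hbX N * (1 + hbEta c N) :=
    Nat.floor_le (by nlinarith)
  have h2 : hbX N - 1 < (⌊hbX N⌋₊ : ℝ) := by
    have := Nat.lt_floor_add_one (hbX N); linarith
  nlinarith

/-- **The pointwise bound** `u(k) = N^{1/3} log k · hbRep(k) ≤ N^{1/3} log N · (ηX + 2)` for
`1 ≤ k ≤ N`, `N > 6`. [cite: HeathBrownActa2001, Theorem 1 (the box X < x, y ≤ X(1+η))] -/
theorem hbWeight_le_max (c : ℝ) {N : ℕ} (hN : 6 < N) {k : ℕ} (hk : k ∈ Icc 1 N) :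
    hbWeight c N k ≤ (N : ℝ) ^ ((1 : ℝ) / 3) * Real.log N * (hbEta c N * hbX N + 2) := by
  unfold hbWeight
  rw [mem_Icc] at hk
  have hk0 : (0 : ℝ) < k := by exact_mod_cast hk.1
  have hlogk : Real.log k ≤ Real.log N := Real.log_le_log hk0 (by exact_mod_cast hk.2)
  have hlogk0 : 0 ≤ Real.log k := Real.log_natCast_nonneg k
  have hlogN0 : 0 ≤ Real.log N := Real.log_natCast_nonneg N
  have hrep : (hbRep c N k : ℝ) ≤ hbEta c N * hbX N + 2 := by
    calc (hbRep c N k : ℝ) ≤ hbSide c N := by exact_mod_cast hbRep_le_hbSide c N k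
      _ ≤ hbEta c N * hbX N + 1 := hbSide_le_eta_mul_X_add_one c hN
      _ ≤ _ := by linarith
  have hrep0 : (0 : ℝ) ≤ hbRep c N k := Nat.cast_nonneg _
  have hN3 : 0 ≤ (N : ℝ) ^ ((1 : ℝ) / 3) := by positivity
  calc (N : ℝ) ^ ((1 : ℝ) / 3) * Real.log k * (hbRep c N k : ℝ)
      ≤ (N : ℝ) ^ ((1 : ℝ) / 3) * Real.log N * (hbRep c N k : ℝ) :=
        mul_le_mul_of_nonneg_right (mul_le_mul_of_nonneg_left hlogk hN3) hrep0
    _ ≤ _ := mul_le_mul_of_nonneg_left hrep (mul_nonneg hN3 hlogN0)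

end Summit.Parity.GeneralizedHardyLittlewood.Theses.RomanoffHeathBrown

end
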